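import Summits.QuantumFields.YangMills.Theorems.UnitScaleTiltFluctuationComparisonRegPrGlobalSlackStepFarTheta
import Summits.QuantumFields.YangMills.Theorems.AlphaInputsT3ACv4CoreRows
import HarnessLib

/-!
# `UnitScaleTiltFluctuationComparisonRegPrGlobalSlackStepFarThetaV4` — THE RECORD-FREE FORM of `…GlobalSlackStepFarTheta` §2 (★★OWNER RULING g26-№14 (F-2b); P22b display branch,
# width seat ym-ust-20520-w2 g4; skeleton v5kD): THE STEP RECORD'S FAR TERMS ARE SEVENTH-ORDER SMALL, `θ(K − b − 1)⁷·e^{−κ dj}`, STATED OVER A FAR-TERM FUNCTION AND ITS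
# DISPLAYED G3D-06 FAR ROW — so that the v3 core (`(q K).runCore.steps b hb).far_le`) AND the v4 rows record (`(q K).runRows.steps b hb).far_le`) are both instances

WHY THIS SHAPE.  `…StepFarTheta`'s `abs_stepFar_le_theta7(_at)` bind `q : ∀ K, PkgCoreV3 …` and read the package only through `((q K).𝔖 b).far` and the step row `far_le`; the
version-4 rows record `PkgCoreRows` (★alpha-2 g7 `AlphaInputsT3ACv4CoreRows`) has the same field and the same row, so the honest common generalisation binds the far-term
function `far` (any history∕field types) and the row `hfar : FarTermsDecayAsCited far …` themselves (no package at all).  Proofs = `…StepFarTheta`'s verbatim (`g_mul_rFun_pow_seven_le`, `θBal_succ_pow_le`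
imported, not restated; the window letter `g_b·p(g_b) = θ(K − b)` is `T3Scales_gk_eq`); callers pass `((q K).runRows.steps b hb).far_le` (rows record) or `((q K).runCore.steps b hb).far_le` (v3 core).
Count-neutral helper (`--supports stmt-QuantumFields-20520`); nothing of [Balaban1985UV3] is asserted beyond the displayed row.  YM₃ on T³ is rung R3 of the programme, not the
Clay problem.

References: T. Bałaban, CMP 102 (1985) 255–275 [Balaban1985UV3] ((5) p.256, (7) p.257, (25) p.262, p.264 L14–20, (57) p.270).
-/

set_option autoImplicit false

noncomputable section

open scoped BigOperators
open Literature.MathematicalPhysics.QuantumFieldTheory.Balaban1983to89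
open Literature.MathematicalPhysics.QuantumFieldTheory.Balaban1983to89.T3ContinuumYM3Torus
open Literature.MathematicalPhysics.QuantumFieldTheory.Balaban1983to89.T3UnitScaleTilt (θBal)
open Literature.MathematicalPhysics.QuantumFieldTheory.Balaban1983to89.TreeLengthTorus (tsys)
open Literature.MathematicalPhysics.QuantumFieldTheory.Balaban1985CMP102
open Literature.MathematicalPhysics.QuantumFieldTheory.Balaban1985CMP102.Setting
open Summit.QuantumFields.Balaban3D.Carriers
open Summit.QuantumFields.Balaban3D.Proofs.Primitives
open Summit.QuantumFields.Balaban3D.Proofs.GroupModelLieC (lieC)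
open Summit.QuantumFields.Balaban3D.Proofs.NewbornJet (tlConst tlConst_nonneg rpow_mul_logpow_le rFun_pow)
open Summit.QuantumFields.Balaban3D.Proofs.ScalesArithmetic (gk_pos gk_le_one)
open Summit.QuantumFields.YangMills.Theorems
open Literature.MathematicalPhysics.QuantumFieldTheory.Balaban1985CMP102.Binders (FarTermsDecayAsCited)

namespace Summit.QuantumFields.YangMills.Theorems.GlobalSlackCanonicalPolymers

/-! ## §1 The far row of ONE step series, seventh-order small -/

section FarRow

variable {F : T3Family} {𝔠 : AlphaConsts F.L (suGroupModel 2).N} {γ : ℝ} {hγ : 0 < γ} {hγ1 : γ ≤ (min 𝔠.gamma0 1) ^ 2}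
  {H C : Type*}

/-- **A STEP SERIES' FAR TERMS ARE `θ(K − b)⁷`-SMALL, FROM ITS DISPLAYED G3D-06 ROW ALONE** (un-shifted form; record-free): for `b + 1 ≤ K`, a step-`b` far-term function `far` of run `K`
with `FarTermsDecayAsCited far (C25·g_b·e^{−κ dj}) Cfar (g_b⁷(r(g_b)p(g_b))⁷)`, every domain `X`, history `h` and field `W`:
`|far X h W| ≤ Cfar·C25·tlConst(7r₀, 1)·θBal F.L γ b₀ p₀ (K − b)⁷·e^{−κ·dj X}` (`g_mul_rFun_pow_seven_le`, `g_b·p(g_b) = θ(K − b)` by `T3Scales_gk_eq`).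
[cite: Balaban1985UV3, p.264 L14-20, (25) p.262, (7) p.257] -/
theorem abs_far_le_theta7_at_of_farRow (K b : ℕ) (hb : b + 1 ≤ K)
    (far : (tsys 3 (nblkOf (SK F 𝔠 γ hγ hγ1 K) 𝔠.lane.carrier b)).Dom → H → C → ℝ)
    (hfar : FarTermsDecayAsCited far
      (fun Y => 𝔠.C25 * (SK F 𝔠 γ hγ hγ1 K).gk b * Real.exp (-(𝔠.κ * (tsys 3 (nblkOf (SK F 𝔠 γ hγ hγ1 K) 𝔠.lane.carrier b)).dj Y)))
      𝔠.Cfar ((SK F 𝔠 γ hγ hγ1 K).gk b ^ 7 * (B10.rFun 𝔠.r₀ ((SK F 𝔠 γ hγ hγ1 K).gk b) * B10.pFun 𝔠.b₀ 𝔠.p₀ ((SK F 𝔠 γ hγ hγ1 K).gk b)) ^ 7))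
    (X : (tsys 3 (nblkOf (SK F 𝔠 γ hγ hγ1 K) 𝔠.lane.carrier b)).Dom) (h : H) (W : C) :
    |far X h W| ≤ 𝔠.Cfar * 𝔠.C25 * tlConst (7 * 𝔠.r₀) 1 * θBal F.L γ 𝔠.b₀ 𝔠.p₀ (K - b) ^ 7 *
      Real.exp (-(𝔠.κ * (tsys 3 (nblkOf (SK F 𝔠 γ hγ hγ1 K) 𝔠.lane.carrier b)).dj X)) := by
  -- letters
  set g : ℝ := (SK F 𝔠 γ hγ hγ1 K).gk b with hgdef
  set pg : ℝ := B10.pFun 𝔠.b₀ 𝔠.p₀ g with hpgdef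
  set r : ℝ := B10.rFun 𝔠.r₀ g with hrdef
  set e : ℝ := Real.exp (-(𝔠.κ * (tsys 3 (nblkOf (SK F 𝔠 γ hγ hγ1 K) 𝔠.lane.carrier b)).dj X)) with hedef
  have hg0 : 0 < g := gk_pos _ b
  have hg1 : g ≤ 1 := gk_le_one _ (SK F 𝔠 γ hγ hγ1 K).gK_le_one b (by show b ≤ K; omega)
  have hpg0 : 0 ≤ pg := B10.pFun_nonneg _ _ _ 𝔠.b₀_pos.le hg0 hg1
  -- the displayed far row
  have hfar' : |far X h W| ≤ 𝔠.Cfar * ((𝔠.C25 * g * e) * (g ^ 7 * (r * pg) ^ 7)) := hfar X h W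
  -- the spare coupling absorbs the polylogarithm
  have hT : g * r ^ 7 ≤ tlConst (7 * 𝔠.r₀) 1 := g_mul_rFun_pow_seven_le (lt_of_lt_of_le one_pos 𝔠.one_le_r₀) hg0 hg1
  -- the window letter `g_b·p(g_b) = θ(K − b)`
  have heps : g * pg = θBal F.L γ 𝔠.b₀ 𝔠.p₀ (K - b) := by
    rw [hpgdef, hgdef, T3Scales_gk_eq F γ hγ _ K b (by omega)]
    rfl
  have hc : 0 ≤ 𝔠.Cfar * 𝔠.C25 * e * (g * pg) ^ 7 := by
    have := 𝔠.Cfar_nonneg; have := 𝔠.C25_nonneg; positivity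
  calc |far X h W| ≤ 𝔠.Cfar * ((𝔠.C25 * g * e) * (g ^ 7 * (r * pg) ^ 7)) := hfar'
    _ = 𝔠.Cfar * 𝔠.C25 * e * (g * pg) ^ 7 * (g * r ^ 7) := by ring
    _ ≤ 𝔠.Cfar * 𝔠.C25 * e * (g * pg) ^ 7 * tlConst (7 * 𝔠.r₀) 1 := mul_le_mul_of_nonneg_left hT hc
    _ = 𝔠.Cfar * 𝔠.C25 * tlConst (7 * 𝔠.r₀) 1 * θBal F.L γ 𝔠.b₀ 𝔠.p₀ (K - b) ^ 7 * e := by rw [← heps]; ring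

/-- **THE SAME IN THE RESIDUAL ROW'S CURRENCY AT THE BIRTH READING** (record-free): `θ` one height up, `|far X h W| ≤
(Cfar·C25·tlConst(7r₀,1)·((√L)⁻¹(1 + log √L)^{p₀})⁷)·θBal F.L γ b₀ p₀ (K − b − 1)⁷·e^{−κ·dj X}` (`θBal_succ_pow_le`, window-free). [cite: Balaban1985UV3, p.264 L14-20, (25) p.262, (5) p.256, (7) p.257, (57) p.270] -/
theorem abs_far_le_theta7_of_farRow (K b : ℕ) (hb : b + 1 ≤ K)
    (far : (tsys 3 (nblkOf (SK F 𝔠 γ hγ hγ1 K) 𝔠.lane.carrier b)).Dom → H → C → ℝ)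
    (hfar : FarTermsDecayAsCited far
      (fun Y => 𝔠.C25 * (SK F 𝔠 γ hγ hγ1 K).gk b * Real.exp (-(𝔠.κ * (tsys 3 (nblkOf (SK F 𝔠 γ hγ hγ1 K) 𝔠.lane.carrier b)).dj Y)))
      𝔠.Cfar ((SK F 𝔠 γ hγ hγ1 K).gk b ^ 7 * (B10.rFun 𝔠.r₀ ((SK F 𝔠 γ hγ hγ1 K).gk b) * B10.pFun 𝔠.b₀ 𝔠.p₀ ((SK F 𝔠 γ hγ hγ1 K).gk b)) ^ 7))
    (X : (tsys 3 (nblkOf (SK F 𝔠 γ hγ hγ1 K) 𝔠.lane.carrier b)).Dom) (h : H) (W : C) :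
    |far X h W| ≤
      (𝔠.Cfar * 𝔠.C25 * tlConst (7 * 𝔠.r₀) 1 * ((Real.sqrt F.L)⁻¹ * (1 + Real.log (Real.sqrt F.L)) ^ 𝔠.p₀) ^ 7) *
        θBal F.L γ 𝔠.b₀ 𝔠.p₀ (K - b - 1) ^ 7 * Real.exp (-(𝔠.κ * (tsys 3 (nblkOf (SK F 𝔠 γ hγ hγ1 K) 𝔠.lane.carrier b)).dj X)) := by
  have hγ1' : γ ≤ 1 := hγ1.trans (sq_min_one_le _ 𝔠.gamma0_pos)
  have hup : θBal F.L γ 𝔠.b₀ 𝔠.p₀ (K - b) ^ 7 ≤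
      ((Real.sqrt F.L)⁻¹ * (1 + Real.log (Real.sqrt F.L)) ^ 𝔠.p₀) ^ 7 * θBal F.L γ 𝔠.b₀ 𝔠.p₀ (K - b - 1) ^ 7 := by
    rw [show K - b = (K - b - 1) + 1 by omega]
    exact θBal_succ_pow_le F.hL.2.le hγ hγ1' 𝔠.b₀_pos.le 𝔠.p₀_pos.le (K - b - 1) 7
  have hc : 0 ≤ 𝔠.Cfar * 𝔠.C25 * tlConst (7 * 𝔠.r₀) 1 := by
    have := 𝔠.Cfar_nonneg; have := 𝔠.C25_nonneg
    have := tlConst_nonneg (q := 7 * 𝔠.r₀) (c := 1) (by linarith [𝔠.one_le_r₀]) one_pos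
    positivity
  have he : 0 ≤ Real.exp (-(𝔠.κ * (tsys 3 (nblkOf (SK F 𝔠 γ hγ hγ1 K) 𝔠.lane.carrier b)).dj X)) := (Real.exp_pos _).le
  calc |far X h W|
      ≤ 𝔠.Cfar * 𝔠.C25 * tlConst (7 * 𝔠.r₀) 1 * θBal F.L γ 𝔠.b₀ 𝔠.p₀ (K - b) ^ 7 *
          Real.exp (-(𝔠.κ * (tsys 3 (nblkOf (SK F 𝔠 γ hγ hγ1 K) 𝔠.lane.carrier b)).dj X)) := abs_far_le_theta7_at_of_farRow K b hb far hfar X h W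
    _ ≤ 𝔠.Cfar * 𝔠.C25 * tlConst (7 * 𝔠.r₀) 1 *
          (((Real.sqrt F.L)⁻¹ * (1 + Real.log (Real.sqrt F.L)) ^ 𝔠.p₀) ^ 7 * θBal F.L γ 𝔠.b₀ 𝔠.p₀ (K - b - 1) ^ 7) *
          Real.exp (-(𝔠.κ * (tsys 3 (nblkOf (SK F 𝔠 γ hγ hγ1 K) 𝔠.lane.carrier b)).dj X)) :=
        mul_le_mul_of_nonneg_right (mul_le_mul_of_nonneg_left hup hc) he
    _ = _ := by ring

end FarRow

end Summit.QuantumFields.YangMills.Theorems.GlobalSlackCanonicalPolymers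

end
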